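import Literature.IUT.LogThetaLattice.HolomorphicHull
import HarnessLib

/-!
# [IUTchIII] Remark 3.9.5 (i): the well-definedness schema `holomorphicHull_isHullSet` — universal closure
# AS TYPED is false (the finite-log-volume guard carries the content)

S. Mochizuki, *Inter-universal Teichmüller theory III*, kurims manuscript (May 2020), §3, Remark 3.9.5 (i)
p. 127: "One verifies immediately that [if `U` contains a relatively compact subset whose log-volume is
finite, then] the holomorphic hull is well-defined" [cite: Mochizuki2012, IUTchIII Rmk. 3.9.5 (i) p. 127].
Claim key `Mochizuki2012`, status DISPUTED (D-0012); this PROOF-ONLY companion (no definitions) of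
`HolomorphicHull.lean` (seat abc-iut-L6) asserts nothing of the series and takes no side on [IUTchIII]
Cor. 3.12.

FACT-LIST row **F-2112** (cell abc-iut, block F, seat abc-iut-f-045).  The decl
`holomorphicHull_isHullSet O FiniteLogVol U := IsCompact (closure U) → FiniteLogVol U →
IsHullSet O (holomorphicHull O U)` is a SCHEMA over arbitrary fields `k_i`, subrings `O_i`, topologies and
an arbitrary predicate `FiniteLogVol` (the printed guard "log-volume finite").  Its universal closure is
FALSE: with one factor `k = ℚ`, `O = ℤ` (`⊥`), the discrete topology, the vacuous guard
`FiniteLogVol := ⊤` and `U = {0}`, every hull-set `λ·ℤ` (`λ ≠ 0`) contains `0`, so the holomorphic hull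
`⋂_{λ ≠ 0} λ·ℤ` is NOT a hull-set: were it `λ₀·ℤ`, then `λ₀ ∈ (2λ₀)·ℤ`, i.e. `1 = 2n`.  (The degenerate
`U = {0}` has log-volume `−∞`; the instance forms of record make the guard honest:
`holomorphicHull_isHullSet_holds` — local fields, `O` the closed unit balls, `FiniteLogVol ⇒ IsNondegenerate`,
`HolomorphicHullBridge.lean` — and `LogVolume.lt_holomorphicHull_isHullSet`, `HullModel.lean`.)  So the
row is admissible AT NAMED INSTANCES ONLY (R5); kernel object below.  A FACT row is an assumption label,
not an endorsement.
-/

namespace Literature.IUT.LogThetaLattice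

/-- **F-2112, universal closure REFUTED.**  At `ι = Unit`, `k = ℚ` (discrete topology), `O = ℤ = ⊥`,
`FiniteLogVol := fun _ => True`, `U = {0}`: `closure U = U` is compact, the guard holds vacuously, and the
holomorphic hull of `{0}` (contained in every `λ·ℤ`, `λ ≠ 0`) is not of the form `λ₀·ℤ` (else
`λ₀ ∈ 2λ₀·ℤ`).  Instance forms of record: `holomorphicHull_isHullSet_holds`,
`LogVolume.lt_holomorphicHull_isHullSet`. [claim: Mochizuki2012, status: disputed]
[cite: Mochizuki2012, IUTchIII Rmk. 3.9.5 (i) p. 127] -/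
theorem not_forall_holomorphicHull_isHullSet :
    ¬ ∀ {ι : Type} {k : ι → Type} [∀ i, Field (k i)] (O : ∀ i, Subring (k i))
        [∀ i, TopologicalSpace (k i)] (FiniteLogVol : Set (∀ i, k i) → Prop) (U : Set (∀ i, k i)),
        holomorphicHull_isHullSet O FiniteLogVol U := by
  intro h
  letI : TopologicalSpace ℚ := ⊥
  haveI : DiscreteTopology ℚ := ⟨rfl⟩
  let O : ∀ _ : Unit, Subring ℚ := fun _ => ⊥
  let U : Set (Unit → ℚ) := {0}
  have hUc : IsCompact (closure U) := by
    rw [(isClosed_discrete U).closure_eq]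
    exact isCompact_singleton
  -- the closure, specialised: the hull of `{0}` is a hull-set `λ₀ · ℤ`
  obtain ⟨lam, hlam, hH⟩ := h (ι := Unit) (k := fun _ => ℚ) O (fun _ => True) U hUc trivial
  -- the hull-set `(2 λ₀) · ℤ` contains `0`, hence contains the hull, hence contains `λ₀`
  have h2 : IsHullSet O (Set.univ.pi fun i => (fun x => 2 * lam i * x) '' (O i : Set ℚ)) :=
    ⟨fun i => 2 * lam i, fun i => mul_ne_zero two_ne_zero (hlam i), rfl⟩
  have h0 : U ⊆ Set.univ.pi fun i => (fun x => 2 * lam i * x) '' (O i : Set ℚ) := by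
    rintro x (rfl : x = 0)
    exact fun i _ => ⟨0, (O i).zero_mem, by simp⟩
  have hsub := holomorphicHull_subset O hUc h2 h0
  have hmem : (fun i => lam i) ∈ holomorphicHull O U := by
    rw [hH]
    exact fun i _ => ⟨1, (O i).one_mem, mul_one _⟩
  obtain ⟨z, hz, hz'⟩ := hsub hmem () (Set.mem_univ _)
  -- `2 λ₀ z = λ₀` with `z ∈ ℤ`: impossible
  obtain ⟨n, rfl⟩ := Subring.mem_bot.mp hz
  have h1 : (2 * n : ℚ) = 1 := by
    have hz'' : 2 * lam () * n = lam () := hz'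
    have h3 : lam () * (2 * n) = lam () * 1 := by
      rw [mul_one, ← mul_assoc, mul_comm (lam ()) 2]
      exact hz''
    exact mul_left_cancel₀ (hlam ()) h3
  have h1' : (2 * n : ℤ) = 1 := by exact_mod_cast h1
  omega

end Literature.IUT.LogThetaLattice
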